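import Literature.MathematicalPhysics.QuantumLattice.BilayerTwoOrbitalBloch
import Literature.MathematicalPhysics.QuantumLattice.LayerStackModes

/-!
# Mirror sectors of a five-plane stack with THREE inequivalent plane classes (outer / next / inner):
# the two odd states never touch the inner plane; the even `3 × 3` block; the equal-plane check

The quintuple-layer square-planar nickelate Nd₆Ni₅O₁₂ (and the five-CuO₂-plane cuprates) has three
crystallographically inequivalent planes — «inner», «middle» (= next-to-outer) and «outer» — which the
correlated-electronic-structure literature treats as three distinct sites (layer-resolved charge-
transfer energies and mass enhancements in [LaBollitaBotana2022, Tables I–II]); at the one-body level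
the five plane orbitals at fixed in-plane momentum couple through a nearest-plane hopping, and «the
splitting in the Ni-d_{x²−y²} bands at X is a consequence of the inter-layer hopping, similar to the
multi-layer cuprates» [LaBollitaBotana2022, §III.A].  The exact kinematics of such a mirror-symmetric
stack is the multilayer even/odd construction of [AndersenEtAl1995, §8]: combinations of plane orbitals
that are odd under the central mirror decouple from the even ones.  This file types the five-plane
case with inequivalent classes — the piece `LayerStackModes.lean` («Not here: … inequivalent outer
planes») and `TrilayerSplittingIdentities.lean` / `TrilayerEvenSectorClosedForm.lean` (three planes)
do not cover:

* §1 the `5 × 5` one-momentum matrix `pentalayerScalar εo εn εi t u` (outer level `εo` on planes 1, 5;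
  next level `εn` on planes 2, 4; inner level `εi` on plane 3; outer–next hopping `t`; next–inner
  hopping `u`);
* §2 the ODD sector: on `(a, b, 0, −b, −a)` the stack acts as the symmetric `2 × 2` block
  `[[εo, t], [t, εn]]` on `(a, b)` (`pentalayer_mulVec_odd`) — the inner plane carries amplitude
  ZERO in every odd vector, whatever `εi` and `u` (`odd_inner_weight`), and the two odd levels are the
  two-level closed form `lvlP/lvlM εo εn t` of `BilayerTwoOrbitalBloch` §3 with the explicit
  eigenvectors `(λ − εn, t, 0, −t, −(λ − εn))` (`pentalayer_mulVec_oddLevel`);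
* §3 the EVEN sector: on `(a, b, c, b, a)` the stack acts as the `3 × 3` block
  `[[εo, t, 0], [t, εn, u], [0, 2u, εi]]` on `(a, b, c)` (`pentalayer_mulVec_even`) — so the single
  inner plane is distributed over the THREE even states only;
* §4 the EQUAL-PLANE CHECK (`εo = εn = εi = ε`, `u = t`): the odd levels are `ε ± t` and the even
  states are `(1, √3, 2, √3, 1)`, `(1, 0, −1, 0, 1)`, `(1, −√3, 2, −√3, 1)` at `ε + √3 t`, `ε`, `ε − √3 t`
  — the five path-graph levels `ε + 2t cos(mπ/6)` of `LayerStackModes` (`N = 5`: `2cos(π/6) = √3`,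
  `2cos(π/3) = 1`, `cos(π/2) = 0`), recovered here from the two sectors (`pentalayer_equal_*`);
  the middle even state `(1, 0, −1, 0, 1)` has ZERO weight on the «next» planes 2 and 4, and at equal
  planes the inner-plane weights of the three even states are `4/12 = 1/3` (top), `1/3` (middle) and
  `1/3` (bottom) (`pentalayer_equal_innerWeights`) — with the two odd zeros the inner plane's unit
  weight is spread equally over the three even states.

Everything is PROVED (matrix-vector identities by `fin_cases`/`simp`/`ring`); no named facts, no axioms
beyond Mathlib's, no `sorry`.  NOT here: closed forms of the three even levels off equality (a cubic),
longer-range inter-plane hopping (outer–inner), `k`-dependence of `t`, any material number.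

References: O. K. Andersen, A. I. Liechtenstein, O. Jepsen, F. Paulsen, J. Phys. Chem. Solids 56 (1995)
1573, arXiv:cond-mat/9509044, §8 (even/odd plane combinations of multilayers); H. LaBollita,
A. S. Botana, Phys. Rev. B 105 (2022) 085118, arXiv:2111.14739, §III.A and Tables I–II (three
inequivalent planes of the quintuple layer; inter-layer splitting at X); P. Van Mieghem, *Graph Spectra
for Complex Networks* (CUP 2010) §6.4 (path-graph levels, as typed in `LayerStackModes`).  AI-produced
formalisation (H21, cell hubbard-downfold, seat lit-1, 2026-08-27).
-/

noncomputable section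

namespace Literature.MathematicalPhysics.QuantumLattice

namespace PentalayerMirror

open Real Matrix

/-! ## §1 The five-plane one-momentum matrix -/

/-- The mirror-symmetric five-plane stack at one momentum: planes (1,2,3,4,5) = (outer, next, inner,
next, outer) with levels `εo, εn, εi, εn, εo`, outer–next hopping `t`, next–inner hopping `u`.
[cite: AndersenEtAl1995, §8] [cite: LaBollitaBotana2022, §III.A] -/
def pentalayerScalar (εo εn εi t u : ℝ) : Matrix (Fin 5) (Fin 5) ℝ :=
  !![εo, t, 0, 0, 0;
     t, εn, u, 0, 0;
     0, u, εi, u, 0;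
     0, 0, u, εn, t;
     0, 0, 0, t, εo]

/-- Unfolding. [cite: AndersenEtAl1995, §8] -/
theorem pentalayerScalar_def (εo εn εi t u : ℝ) :
    pentalayerScalar εo εn εi t u =
      !![εo, t, 0, 0, 0; t, εn, u, 0, 0; 0, u, εi, u, 0; 0, 0, u, εn, t; 0, 0, 0, t, εo] := rfl

/-! ## §2 The odd sector: a `2 × 2` block that never touches the inner plane -/

/-- **Odd sector.** On a mirror-odd vector `(a, b, 0, −b, −a)` the stack acts as `[[εo, t], [t, εn]]` on
`(a, b)`; the inner component of the image is `0` for every `εi`, `u`.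
[cite: AndersenEtAl1995, §8 Eq. (23)] -/
theorem pentalayer_mulVec_odd (εo εn εi t u a b : ℝ) :
    pentalayerScalar εo εn εi t u *ᵥ ![a, b, 0, -b, -a]
      = ![εo * a + t * b, t * a + εn * b, 0, -(t * a + εn * b), -(εo * a + t * b)] := by
  ext i
  fin_cases i <;> simp [pentalayerScalar, Matrix.mulVec, dotProduct, Fin.sum_univ_five]

/-- Every odd vector has inner-plane weight exactly `0` (squared inner amplitude over squared norm).
[cite: AndersenEtAl1995, §8] [cite: LaBollitaBotana2022, Table II] -/
theorem odd_inner_weight (a b : ℝ) :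
    ((![a, b, 0, -b, -a] : Fin 5 → ℝ) 2) ^ 2 /
      (((![a, b, 0, -b, -a] : Fin 5 → ℝ) 0) ^ 2 + ((![a, b, 0, -b, -a] : Fin 5 → ℝ) 1) ^ 2 +
        ((![a, b, 0, -b, -a] : Fin 5 → ℝ) 2) ^ 2 + ((![a, b, 0, -b, -a] : Fin 5 → ℝ) 3) ^ 2 +
        ((![a, b, 0, -b, -a] : Fin 5 → ℝ) 4) ^ 2) = 0 := by
  simp

/-- The odd eigen-condition: `(a, b, 0, −b, −a)` is an eigenvector with eigenvalue `λ` as soon as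
`(a, b)` is an eigenvector of `[[εo, t], [t, εn]]`. [cite: AndersenEtAl1995, §8 Eq. (23)] -/
theorem pentalayer_mulVec_odd_of_twoLevel (εo εn εi t u a b lam : ℝ)
    (h1 : εo * a + t * b = lam * a) (h2 : t * a + εn * b = lam * b) :
    pentalayerScalar εo εn εi t u *ᵥ ![a, b, 0, -b, -a] = lam • ![a, b, 0, -b, -a] := by
  rw [pentalayer_mulVec_odd]
  ext i
  fin_cases i <;> simp [h1, h2]

/-- The two odd levels are the symmetric two-level closed form `λ_± = (εo + εn)/2 ± √(((εo − εn)/2)² + t²)`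
with eigenvectors `(λ − εn, t, 0, −t, −(λ − εn))`: upper level. [cite: AndersenEtAl1995, §8]
[cite: LuoEtAl2023, Eq. (3)] -/
theorem pentalayer_mulVec_oddLevelP (εo εn εi t u : ℝ) :
    pentalayerScalar εo εn εi t u *ᵥ
        ![BilayerTwoOrbital.lvlP εo εn t - εn, t, 0, -t, -(BilayerTwoOrbital.lvlP εo εn t - εn)]
      = BilayerTwoOrbital.lvlP εo εn t •
        ![BilayerTwoOrbital.lvlP εo εn t - εn, t, 0, -t, -(BilayerTwoOrbital.lvlP εo εn t - εn)] := by
  have hs := BilayerTwoOrbital.lvlP_add_lvlM εo εn t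
  have hp := BilayerTwoOrbital.lvlP_mul_lvlM εo εn t
  apply pentalayer_mulVec_odd_of_twoLevel
  · -- εo (λ − εn) + t² = λ (λ − εn)  ⇔  λ² − (εo+εn) λ + εo εn − t² = 0
    linear_combination (-(BilayerTwoOrbital.lvlP εo εn t)) * hs + hp
  · ring

/-- … and lower level. [cite: AndersenEtAl1995, §8] [cite: LuoEtAl2023, Eq. (3)] -/
theorem pentalayer_mulVec_oddLevelM (εo εn εi t u : ℝ) :
    pentalayerScalar εo εn εi t u *ᵥ
        ![BilayerTwoOrbital.lvlM εo εn t - εn, t, 0, -t, -(BilayerTwoOrbital.lvlM εo εn t - εn)]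
      = BilayerTwoOrbital.lvlM εo εn t •
        ![BilayerTwoOrbital.lvlM εo εn t - εn, t, 0, -t, -(BilayerTwoOrbital.lvlM εo εn t - εn)] := by
  have hs := BilayerTwoOrbital.lvlP_add_lvlM εo εn t
  have hp := BilayerTwoOrbital.lvlP_mul_lvlM εo εn t
  apply pentalayer_mulVec_odd_of_twoLevel
  · linear_combination (-(BilayerTwoOrbital.lvlM εo εn t)) * hs + hp
  · ring

/-- The odd levels do not depend on the inner level `εi` nor on the next–inner hopping `u` (they are
functions of `εo, εn, t` only), and their splitting is `2√(((εo − εn)/2)² + t²) ≥ |εo − εn|`.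
[cite: AndersenEtAl1995, §8] [cite: LuoEtAl2023, Eq. (3)] -/
theorem oddSplitting (εo εn t : ℝ) :
    BilayerTwoOrbital.lvlP εo εn t - BilayerTwoOrbital.lvlM εo εn t
        = 2 * sqrt (((εo - εn) / 2) ^ 2 + t ^ 2) ∧
      |εo - εn| ≤ BilayerTwoOrbital.lvlP εo εn t - BilayerTwoOrbital.lvlM εo εn t :=
  BilayerTwoOrbital.lvlP_sub_lvlM εo εn t

/-! ## §3 The even sector: a `3 × 3` block carrying the whole inner plane -/

/-- **Even sector.** On a mirror-even vector `(a, b, c, b, a)` the stack acts as the block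
`[[εo, t, 0], [t, εn, u], [0, 2u, εi]]` on `(a, b, c)`. [cite: AndersenEtAl1995, §8 Eq. (23)] -/
theorem pentalayer_mulVec_even (εo εn εi t u a b c : ℝ) :
    pentalayerScalar εo εn εi t u *ᵥ ![a, b, c, b, a]
      = ![εo * a + t * b, t * a + εn * b + u * c, 2 * u * b + εi * c,
          t * a + εn * b + u * c, εo * a + t * b] := by
  ext i
  fin_cases i <;> simp [pentalayerScalar, Matrix.mulVec, dotProduct, Fin.sum_univ_five] <;> ring

/-- The even eigen-condition in block form. [cite: AndersenEtAl1995, §8 Eq. (23)] -/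
theorem pentalayer_mulVec_even_of_block (εo εn εi t u a b c lam : ℝ)
    (h1 : εo * a + t * b = lam * a) (h2 : t * a + εn * b + u * c = lam * b)
    (h3 : 2 * u * b + εi * c = lam * c) :
    pentalayerScalar εo εn εi t u *ᵥ ![a, b, c, b, a] = lam • ![a, b, c, b, a] := by
  rw [pentalayer_mulVec_even]
  ext i
  fin_cases i <;> simp [h1, h2, h3]

/-- Odd and even vectors are orthogonal for all amplitudes (the mirror sectors do not mix).
[cite: AndersenEtAl1995, §8] -/
theorem odd_even_orthogonal (a b a' b' c' : ℝ) :
    dotProduct (![a, b, 0, -b, -a] : Fin 5 → ℝ) ![a', b', c', b', a'] = 0 := by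
  simp [dotProduct, Fin.sum_univ_five]

/-! ## §4 The equal-plane check against the path-graph levels of `LayerStackModes` (`N = 5`) -/

/-- Equal planes, odd sector: `(1, 1, 0, −1, −1)` at `ε + t` … [cite: VanMieghem2010, §6.4 Eq. (6.8)] -/
theorem pentalayer_equal_oddP (ε t : ℝ) :
    pentalayerScalar ε ε ε t t *ᵥ ![1, 1, 0, -1, -1] = (ε + t) • ![1, 1, 0, -1, -1] := by
  have h := pentalayer_mulVec_odd_of_twoLevel ε ε ε t t 1 1 (ε + t) (by ring) (by ring)
  simpa using h

/-- … and `(1, −1, 0, 1, −1)` at `ε − t` — the `2cos(2π/6) = 1` modes. [cite: VanMieghem2010, §6.4 Eq. (6.8)] -/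
theorem pentalayer_equal_oddM (ε t : ℝ) :
    pentalayerScalar ε ε ε t t *ᵥ ![1, -1, 0, 1, -1] = (ε - t) • ![1, -1, 0, 1, -1] := by
  have h := pentalayer_mulVec_odd_of_twoLevel ε ε ε t t 1 (-1) (ε - t) (by ring) (by ring)
  simpa using h

/-- Equal planes, even sector, top: `(1, √3, 2, √3, 1)` at `ε + √3 t` — the `2cos(π/6) = √3` mode.
[cite: VanMieghem2010, §6.4 Eq. (6.8)] -/
theorem pentalayer_equal_evenTop (ε t : ℝ) :
    pentalayerScalar ε ε ε t t *ᵥ ![1, sqrt 3, 2, sqrt 3, 1]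
      = (ε + sqrt 3 * t) • ![1, sqrt 3, 2, sqrt 3, 1] := by
  have h3 : sqrt 3 * sqrt 3 = 3 := mul_self_sqrt (by norm_num)
  apply pentalayer_mulVec_even_of_block
  · ring
  · linear_combination (-t) * h3
  · ring

/-- Equal planes, even sector, middle: `(1, 0, −1, 0, 1)` at `ε` — the `cos(π/2) = 0` mode, with ZERO
weight on the «next» planes 2 and 4. [cite: VanMieghem2010, §6.4 Eq. (6.8)] -/
theorem pentalayer_equal_evenMid (ε t : ℝ) :
    pentalayerScalar ε ε ε t t *ᵥ ![1, 0, -1, 0, 1] = ε • ![1, 0, -1, 0, 1] := by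
  have h := pentalayer_mulVec_even_of_block ε ε ε t t 1 0 (-1) ε (by ring) (by ring) (by ring)
  simpa using h

/-- Equal planes, even sector, bottom: `(1, −√3, 2, −√3, 1)` at `ε − √3 t`.
[cite: VanMieghem2010, §6.4 Eq. (6.8)] -/
theorem pentalayer_equal_evenBot (ε t : ℝ) :
    pentalayerScalar ε ε ε t t *ᵥ ![1, -sqrt 3, 2, -sqrt 3, 1]
      = (ε - sqrt 3 * t) • ![1, -sqrt 3, 2, -sqrt 3, 1] := by
  have h3 : sqrt 3 * sqrt 3 = 3 := mul_self_sqrt (by norm_num)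
  apply pentalayer_mulVec_even_of_block
  · ring
  · linear_combination (-t) * h3
  · ring

/-- The equal-plane levels found here are the `LayerStackModes` values: `√3 = 2cos(π/6)` and
`1 = 2cos(π/3)`. [cite: VanMieghem2010, §6.4 Eq. (6.8)] -/
theorem equal_levels_are_stackModes :
    sqrt 3 = 2 * cos (π / 6) ∧ (1:ℝ) = 2 * cos (π / 3) :=
  ⟨two_mul_cos_pi_div_six.symm, two_mul_cos_pi_div_three.symm⟩

/-- Inner-plane weights of the three equal-plane even states: `4/(1+3+4+3+1) = 1/3` (top), `1/3`
(middle: `1/(1+0+1+0+1)`), `1/3` (bottom) — with the two odd zeros the inner plane's unit weight is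
spread equally over the three even states at equal planes. [cite: VanMieghem2010, §6.4 Eq. (6.9)] -/
theorem pentalayer_equal_innerWeights :
    (2:ℝ) ^ 2 / (1 ^ 2 + sqrt 3 ^ 2 + 2 ^ 2 + sqrt 3 ^ 2 + 1 ^ 2) = 1 / 3 ∧
      ((-1:ℝ)) ^ 2 / (1 ^ 2 + 0 ^ 2 + (-1) ^ 2 + 0 ^ 2 + 1 ^ 2) = 1 / 3 ∧
        (2:ℝ) ^ 2 / (1 ^ 2 + (-sqrt 3) ^ 2 + 2 ^ 2 + (-sqrt 3) ^ 2 + 1 ^ 2) = 1 / 3 := by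
  have h3 : sqrt 3 ^ 2 = 3 := sq_sqrt (by norm_num)
  refine ⟨?_, ?_, ?_⟩
  · rw [h3]; norm_num
  · norm_num
  · rw [neg_pow_two, h3]; norm_num

/-- At equal planes the «next»-plane weight of the middle even state is exactly `0` while each odd state
puts weight `1/4 + 1/4 = 1/2` on the two next planes: the three plane CLASSES see the five states very
differently even before any level offset. [cite: VanMieghem2010, §6.4 Eq. (6.9)] -/
theorem pentalayer_equal_nextWeights :
    ((0:ℝ) ^ 2 + 0 ^ 2) / (1 ^ 2 + 0 ^ 2 + (-1) ^ 2 + 0 ^ 2 + 1 ^ 2) = 0 ∧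
      ((1:ℝ) ^ 2 + (-1) ^ 2) / (1 ^ 2 + 1 ^ 2 + 0 ^ 2 + (-1) ^ 2 + (-1) ^ 2) = 1 / 2 := by
  constructor <;> norm_num

end PentalayerMirror

end Literature.MathematicalPhysics.QuantumLattice

end
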